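import Summits.Ventures.YMGap.RobustBall.LangevinPoincareDLR
import Summits.Ventures.YMGap.RobustBall.HeatBathConcentration
import Summits.Ventures.YMGap.Thresholds.LatticeBakryEmeryLipschitz
import Summits.Ventures.YMGap.Thresholds.OneLinkModulusSU3Twisted
import Literature.MathematicalPhysics.QuantumFieldTheory.Balaban1983to89.StrongCouplingKernelWindow
import HarnessLib

/-!
# Robust ball (Y2) — GRADIENT-FORM EXPONENTIAL CONCENTRATION IN EVERY GIBBS STATE: `μ{F − E_μ F ≥ r} ≤ e^{2/3} exp(−r/√(A ∑_e L_e²))` for smooth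
# per-link-Lipschitz cylinder observables of strong-coupling `SU(N)` lattice Yang–Mills (Aida–Stroock on the Langevin Poincaré inequality)

HONEST FRAMING: venture file of the cell `pub-ymgap` (QuantumFields programme), track ROBUST-BALL, seat rb-p2 (g16); the gradient-form companion of
`HeatBathConcentrationDLR.lean` (g14: Aida–Stroock on the OSCILLATION form of the Gibbs-state heat-bath Poincaré inequality, rate `1/√(2A'‖δ‖₂²)` with the
sup-oscillations `δ`).  Here the input is `LangevinPoincareDLR.gibbs_variance_le_integral_Gam_of_oneLinkKRModulus` (g14: `Var_μ(F) ≤ A ∫ Γ(f,f) dμ`,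
`A = ((1 − c)K₀)⁻¹`, for EVERY DLR state on the Kantorovich–Rubinstein window) and the frame bound `Γ(u,u) ≤ ∑_e L_e²` for per-link Frobenius-Lipschitz `u`
(`LatticeBakryEmery.Gam_le_of_linkLipschitz`).  LATTICE statements at STRONG COUPLING, Wilson action (class K); nothing about `β → ∞`, the continuum or Clay.

THE STATEMENT ('t Hooft coupling `β`, bare `Nβ`; `2(d−1)|β| ≤ R`, `OneLinkKRModulus N R K`, `c := 6(d−1)|β|K < 1`, `K₀ := N/2 − 2(d−1)N|β| > 0`, `A := ((1 − c)K₀)⁻¹`):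
for EVERY DLR state `μ`, every finite link set `Δ`, every smooth `f` of the link matrices over `Δ` with `LinkLipschitz f L` (`L ≥ 0`, `∑_e L_e² > 0`), `F = f((U_e)_{e∈Δ})`:
★★ `gibbs_measureReal_deviation_ge_le_of_linkLipschitz`: `μ{F − E_μ F ≥ r} ≤ e^{2/3} exp(−r/√(A ∑_e L_e²))` for every `r` (and the lower tail `…_le_le_…`, the two-sided
`…_abs_ge_le_…` with the factor `2`).  The point versus the oscillation form: `∑_e L_e²` carries the GRADIENT size of `F` — for the normalised plaquette or any
normalised Wilson loop `(1/N) Re tr`, `L_e = O(N^{-1/2})` per link while `K₀ = O(N)`, so `A ∑_e L_e² = O(N⁻²)` and the tails are `exp(−Θ(N)·r)`: EXPONENTIAL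
CONCENTRATION AT RATE `N` of gauge-invariant loop observables in every Gibbs state at fixed 't Hooft coupling (cells for named observables live with
`LangevinPoincareDLRLipschitz.plaqFun_linkLipschitz`).  Cells here (in `L`): `su2_gibbs_measureReal_deviation_abs_ge_le_of_linkLipschitz` — `SU(2)`, `d = 4`,
`0 ≤ β_W < 2/9`: `μ{|F − E_μ F| ≥ r} ≤ 2e^{2/3} exp(−r √((1 − 9β_W/2)(1 − 3β_W)/∑_e L_e²))`; `suN_…_bakryEmery` — every `N ≥ 2`, `d = 4`, `0 ≤ b < 1/48`:
`2e^{2/3} exp(−r √(N(1/2 − 24b)/∑_e L_e²))`; `su3_…_pv2t` — `SU(3)`, twisted modulus, `0 ≤ β_W < 1000/3531`: `2e^{2/3} exp(−r √((1 − 3531β_W/1000)(3/2 − 2β_W)/∑_e L_e²))`.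
MECHANISM (Aida–Stroock / Gromov–Milman, tree `HeatBathConcentration.measureReal_ge_le_of_variance_exp_le`): for `t ≥ 0` the function `e^{t(f − m)/2}` is a smooth
cylinder function with `Γ(e^{t(f−m)/2}) = (t²/4) e^{t(f−m)} Γ(f,f) ≤ (t²/4) e^{t(f−m)} ∑_e L_e²` on `SU(N)^Δ` (`Gam_exp_mul`), so the Langevin Poincaré inequality gives
`Var_μ(e^{tG/2}) ≤ (A∑_e L_e²)(t²/4) E_μ e^{tG}` for `G = F − E_μ F`, which is the input of the iteration.  0 sorry, 0 definitions.  References: S. Aida, D. Stroock,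
Math. Res. Lett. 1 (1994) 75–86; M. Ledoux, The Concentration of Measure Phenomenon (2001), §3.1 / Cor. 3.2 (Gromov–Milman); H. Shen, R. Zhu, X. Zhu, CMP 400
(2023) 805–851, Rem. 1.3.  Everything here is proved. [folklore]
-/

noncomputable section

open scoped Matrix ComplexConjugate BigOperators Matrix.Norms.Frobenius ContDiff Topology ProbabilityTheory NNReal
open Matrix Complex Finset MeasureTheory Filter ProbabilityTheory Function Real
open Literature.Probability.LatticeModels Literature.Probability.LatticeModels.DobrushinMetric
open Literature.MathematicalPhysics.QuantumLattice hiding torusNorm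
open Literature.MathematicalPhysics.QuantumFieldTheory hiding ZdEdge
open Summit.QuantumFields.YangMills.Theorems.StrongPinningPoincare
open Literature.MathematicalPhysics.QuantumFieldTheory.SUNBakryEmery (SUN FrameIdx frame)
open Literature.MathematicalPhysics.QuantumFieldTheory.Balaban1983to89.StrongCouplingDobrushinWindow (OneLinkKRModulus)
open Summit.Ventures.YMGap.LatticeBakryEmery

namespace Summit.Ventures.YMGap.RobustBall.LangevinPoincare

variable {d N : ℕ}

/-! ### Calculus: `Γ` of an exponential -/

section Calculus

variable {ι : Type*} [Fintype ι] [DecidableEq ι]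

/-- **`Γ(e^{s u}, e^{s u}) = (s e^{s u})² Γ(u,u)`** (chain rule for the carré du champ of `SU(N)^ι`). [folklore] -/
theorem Gam_exp_mul {u : Cfg ι N → ℝ} (hu : ContDiff ℝ ∞ u) (s : ℝ) (Q : Cfg ι N) :
    Gam (fun Q => Real.exp (s * u Q)) (fun Q => Real.exp (s * u Q)) Q = (s * Real.exp (s * u Q)) ^ 2 * Gam u u Q := by
  have hsu : ContDiff ℝ ∞ fun Q => s * u Q := contDiff_const.mul hu
  rw [Gam_self_eq_sum_sq, Gam_self_eq_sum_sq, mul_sum]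
  refine sum_congr rfl fun a _ => ?_
  rw [algD_exp hsu, algD_const_mul hu]
  ring

omit [Fintype ι] [DecidableEq ι] in
/-- A per-link Lipschitz function stays per-link Lipschitz (same constants) after subtracting a constant. [folklore] -/
theorem linkLipschitz_sub_const {u : Cfg ι N → ℝ} {L : ι → ℝ} (hLip : LinkLipschitz u L) (m : ℝ) :
    LinkLipschitz (fun Q => u Q - m) L := fun e g h hgh => by
  simpa using hLip e g h hgh

end Calculus

/-! ### Aida–Stroock in every Gibbs state, gradient form -/

section Gibbs

/-- **The exponential-moment Poincaré step in every DLR state**: under the window hypotheses, for every smooth per-link-Lipschitz `f` over `Δ` and every real `t`,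
with `G := F − E_μ F`, `F = f((U_e)_{e∈Δ})`: `Var_μ(e^{tG/2}) ≤ (A ∑_e L_e²)·(t²/4)·E_μ e^{tG}`, `A = ((1 − c)K₀)⁻¹`. [folklore] -/
theorem gibbs_variance_exp_half_le_of_linkLipschitz (hd : 1 ≤ d) (hN : 1 ≤ N) {β R K c : ℝ} (hK : 0 ≤ K)
    (hR : |β| * (2 * ((d : ℝ) - 1)) ≤ R) (hmod : OneLinkKRModulus N R K) (hc : 6 * ((d : ℝ) - 1) * |β| * K ≤ c) (hc1 : c < 1)
    (hK₀ : 0 < (N : ℝ) / 2 - N * |β| * (2 * ((d : ℝ) - 1)))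
    {μ : Measure (LGConfig d (SUN N))} (hμ : μ ∈ ymGibbsMeasures (d := d) (fundamentalRep (Fin N)) ((N : ℝ) * β))
    (Δ : Finset (ZdEdge d)) {f : Cfg ↥Δ N → ℝ} (hf : ContDiff ℝ ∞ f) {L : ↥Δ → ℝ} (hL : ∀ e, 0 ≤ L e) (hLip : LinkLipschitz f L) (t : ℝ) :
    Var[fun U => Real.exp (t / 2 * (matrixCylinder Δ f U - ∫ V, matrixCylinder Δ f V ∂μ)); μ] ≤
      ((1 - c) * ((N : ℝ) / 2 - N * |β| * (2 * ((d : ℝ) - 1))))⁻¹ * (∑ e, L e ^ 2) * t ^ 2 / 4 *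
        mgf (fun U => matrixCylinder Δ f U - ∫ V, matrixCylinder Δ f V ∂μ) μ t := by
  have hN0 : N ≠ 0 := by omega
  have hμ' : IsGibbsMeasure (ymSpecification (d := d) (fundamentalRep (Fin N)) ((N : ℝ) * β)) μ := hμ
  haveI := hμ'.isProbabilityMeasure
  set m : ℝ := ∫ V, matrixCylinder Δ f V ∂μ with hm
  -- the centred function and its exponential, as smooth cylinder functions
  set u : Cfg ↥Δ N → ℝ := fun Q => f Q - m with hu
  have huc : ContDiff ℝ ∞ u := hf.sub contDiff_const
  have huL : LinkLipschitz u L := linkLipschitz_sub_const hLip m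
  set h : Cfg ↥Δ N → ℝ := fun Q => Real.exp (t / 2 * u Q) with hh
  have hhc : ContDiff ℝ ∞ h := (contDiff_const.mul huc).exp
  have key := gibbs_variance_le_integral_Gam_of_oneLinkKRModulus hd hN hK hR hmod hc hc1 hK₀ hμ Δ hhc
  have hFh : matrixCylinder Δ h = fun U => Real.exp (t / 2 * (matrixCylinder Δ f U - m)) := rfl
  rw [hFh] at key
  -- pointwise: `Γ(h,h) = (t/2)² e^{t u} Γ(u,u) ≤ (t²/4) e^{t G} ∑ L²`
  set G : LGConfig d (SUN N) → ℝ := fun U => matrixCylinder Δ f U - m with hG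
  have hpt : ∀ U : LGConfig d (SUN N), Gam h h (fun e : ↥Δ => (U e : Matrix (Fin N) (Fin N) ℂ)) ≤
      (∑ e, L e ^ 2) * t ^ 2 / 4 * Real.exp (t * G U) := by
    intro U
    have h1 := Gam_exp_mul (N := N) huc (t / 2) (fun e : ↥Δ => (U e : Matrix (Fin N) (Fin N) ℂ))
    have h2 : Gam u u (fun e : ↥Δ => (U e : Matrix (Fin N) (Fin N) ℂ)) ≤ ∑ e, L e ^ 2 :=
      Gam_le_of_linkLipschitz hN0 huc hL huL (fun e : ↥Δ => U e)
    have h3 : (t / 2 * Real.exp (t / 2 * u (fun e : ↥Δ => (U e : Matrix (Fin N) (Fin N) ℂ)))) ^ 2 = t ^ 2 / 4 * Real.exp (t * G U) := by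
      rw [mul_pow, sq (Real.exp _), ← Real.exp_add]
      congr 1
      · ring
      · congr 1; simp only [hG, hu, matrixCylinder]; ring
    show Gam h h _ ≤ _
    rw [hh, h1, h3]
    have h4 : 0 ≤ t ^ 2 / 4 * Real.exp (t * G U) := by positivity
    calc t ^ 2 / 4 * Real.exp (t * G U) * Gam u u (fun e : ↥Δ => (U e : Matrix (Fin N) (Fin N) ℂ))
        ≤ t ^ 2 / 4 * Real.exp (t * G U) * ∑ e, L e ^ 2 := mul_le_mul_of_nonneg_left h2 h4
      _ = (∑ e, L e ^ 2) * t ^ 2 / 4 * Real.exp (t * G U) := by ring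
  -- `G` is bounded and measurable, so `e^{tG}` is integrable
  have hFc : Continuous (matrixCylinder Δ f) := hf.continuous.comp (continuous_pi fun e => continuous_subtype_val.comp (continuous_apply _))
  have hGc : Continuous G := hFc.sub continuous_const
  obtain ⟨M, hM⟩ := exists_bound_of_continuous hGc
  have hexp : Integrable (fun U => (∑ e, L e ^ 2) * t ^ 2 / 4 * Real.exp (t * G U)) μ := by
    refine (HeatBath.integrable_of_abs_le ((hGc.measurable.const_mul t).exp) (C := Real.exp (|t| * M)) fun U => ?_).const_mul _
    rw [abs_of_pos (Real.exp_pos _), Real.exp_le_exp]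
    calc t * G U ≤ |t * G U| := le_abs_self _
      _ = |t| * |G U| := abs_mul _ _
      _ ≤ |t| * M := mul_le_mul_of_nonneg_left (hM U) (abs_nonneg _)
  have hint : ∫ U, Gam h h (fun e : ↥Δ => (U e : Matrix (Fin N) (Fin N) ℂ)) ∂μ ≤ (∑ e, L e ^ 2) * t ^ 2 / 4 * mgf G μ t := by
    calc ∫ U, Gam h h (fun e : ↥Δ => (U e : Matrix (Fin N) (Fin N) ℂ)) ∂μ ≤ ∫ U, (∑ e, L e ^ 2) * t ^ 2 / 4 * Real.exp (t * G U) ∂μ :=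
          integral_mono_of_nonneg (ae_of_all _ fun U => Gam_self_nonneg _ _) hexp (ae_of_all _ hpt)
      _ = (∑ e, L e ^ 2) * t ^ 2 / 4 * mgf G μ t := by rw [integral_const_mul]; rfl
  have hA : 0 ≤ ((1 - c) * ((N : ℝ) / 2 - N * |β| * (2 * ((d : ℝ) - 1))))⁻¹ := inv_nonneg.2 (mul_pos (by linarith) hK₀).le
  calc Var[fun U => Real.exp (t / 2 * (matrixCylinder Δ f U - m)); μ]
      ≤ ((1 - c) * ((N : ℝ) / 2 - N * |β| * (2 * ((d : ℝ) - 1))))⁻¹ * ∫ U, Gam h h (fun e : ↥Δ => (U e : Matrix (Fin N) (Fin N) ℂ)) ∂μ := key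
    _ ≤ ((1 - c) * ((N : ℝ) / 2 - N * |β| * (2 * ((d : ℝ) - 1))))⁻¹ * ((∑ e, L e ^ 2) * t ^ 2 / 4 * mgf G μ t) :=
        mul_le_mul_of_nonneg_left hint hA
    _ = _ := by ring

/-- ★★ **GRADIENT-FORM EXPONENTIAL CONCENTRATION IN EVERY GIBBS STATE, upper tail**: under the window hypotheses, for every DLR state `μ`, every smooth `f` over
a finite `Δ` with `LinkLipschitz f L` (`L ≥ 0`, `∑_e L_e² > 0`) and every `r`,
`μ{F − E_μ F ≥ r} ≤ e^{2/3} exp(−r/√(A ∑_e L_e²))`, `A = ((1 − c)K₀)⁻¹`, `F = f((U_e)_{e∈Δ})`. [folklore] -/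
theorem gibbs_measureReal_deviation_ge_le_of_linkLipschitz (hd : 1 ≤ d) (hN : 1 ≤ N) {β R K c : ℝ} (hK : 0 ≤ K)
    (hR : |β| * (2 * ((d : ℝ) - 1)) ≤ R) (hmod : OneLinkKRModulus N R K) (hc : 6 * ((d : ℝ) - 1) * |β| * K ≤ c) (hc1 : c < 1)
    (hK₀ : 0 < (N : ℝ) / 2 - N * |β| * (2 * ((d : ℝ) - 1)))
    {μ : Measure (LGConfig d (SUN N))} (hμ : μ ∈ ymGibbsMeasures (d := d) (fundamentalRep (Fin N)) ((N : ℝ) * β))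
    (Δ : Finset (ZdEdge d)) {f : Cfg ↥Δ N → ℝ} (hf : ContDiff ℝ ∞ f) {L : ↥Δ → ℝ} (hL : ∀ e, 0 ≤ L e) (hLip : LinkLipschitz f L)
    (hpos : 0 < ∑ e, L e ^ 2) (r : ℝ) :
    μ.real {U | r ≤ matrixCylinder Δ f U - ∫ V, matrixCylinder Δ f V ∂μ} ≤
      Real.exp (2 / 3) * Real.exp (-r / Real.sqrt (((1 - c) * ((N : ℝ) / 2 - N * |β| * (2 * ((d : ℝ) - 1))))⁻¹ * ∑ e, L e ^ 2)) := by
  have hμ' : IsGibbsMeasure (ymSpecification (d := d) (fundamentalRep (Fin N)) ((N : ℝ) * β)) μ := hμ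
  haveI := hμ'.isProbabilityMeasure
  set m : ℝ := ∫ V, matrixCylinder Δ f V ∂μ with hm
  set G : LGConfig d (SUN N) → ℝ := fun U => matrixCylinder Δ f U - m with hG
  have hFc : Continuous (matrixCylinder Δ f) := hf.continuous.comp (continuous_pi fun e => continuous_subtype_val.comp (continuous_apply _))
  have hGc : Continuous G := hFc.sub continuous_const
  obtain ⟨M, hM⟩ := exists_bound_of_continuous hGc
  obtain ⟨MF, hMF⟩ := exists_bound_of_continuous hFc
  have hmean : ∫ U, G U ∂μ = 0 := by
    simp only [hG]
    rw [integral_sub (HeatBath.integrable_of_abs_le hFc.measurable hMF) (integrable_const _), integral_const, smul_eq_mul]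
    simp [hm]
  have hκ : 0 < ((1 - c) * ((N : ℝ) / 2 - N * |β| * (2 * ((d : ℝ) - 1))))⁻¹ * ∑ e, L e ^ 2 :=
    mul_pos (inv_pos.2 (mul_pos (by linarith) hK₀)) hpos
  have hvar : ∀ t : ℝ, 0 ≤ t → Var[fun U => Real.exp (t / 2 * G U); μ] ≤
      ((1 - c) * ((N : ℝ) / 2 - N * |β| * (2 * ((d : ℝ) - 1))))⁻¹ * (∑ e, L e ^ 2) * t ^ 2 / 4 * mgf G μ t :=
    fun t _ => gibbs_variance_exp_half_le_of_linkLipschitz hd hN hK hR hmod hc hc1 hK₀ hμ Δ hf hL hLip t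
  exact HeatBathConcentration.measureReal_ge_le_of_variance_exp_le μ hGc.measurable hM hmean hκ hvar r

/-- ★★ **Lower tail**: `μ{F − E_μ F ≤ −r} ≤ e^{2/3} exp(−r/√(A ∑_e L_e²))` (the upper tail for `−f`, which has the same per-link constants). [folklore] -/
theorem gibbs_measureReal_deviation_le_le_of_linkLipschitz (hd : 1 ≤ d) (hN : 1 ≤ N) {β R K c : ℝ} (hK : 0 ≤ K)
    (hR : |β| * (2 * ((d : ℝ) - 1)) ≤ R) (hmod : OneLinkKRModulus N R K) (hc : 6 * ((d : ℝ) - 1) * |β| * K ≤ c) (hc1 : c < 1)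
    (hK₀ : 0 < (N : ℝ) / 2 - N * |β| * (2 * ((d : ℝ) - 1)))
    {μ : Measure (LGConfig d (SUN N))} (hμ : μ ∈ ymGibbsMeasures (d := d) (fundamentalRep (Fin N)) ((N : ℝ) * β))
    (Δ : Finset (ZdEdge d)) {f : Cfg ↥Δ N → ℝ} (hf : ContDiff ℝ ∞ f) {L : ↥Δ → ℝ} (hL : ∀ e, 0 ≤ L e) (hLip : LinkLipschitz f L)
    (hpos : 0 < ∑ e, L e ^ 2) (r : ℝ) :
    μ.real {U | matrixCylinder Δ f U - ∫ V, matrixCylinder Δ f V ∂μ ≤ -r} ≤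
      Real.exp (2 / 3) * Real.exp (-r / Real.sqrt (((1 - c) * ((N : ℝ) / 2 - N * |β| * (2 * ((d : ℝ) - 1))))⁻¹ * ∑ e, L e ^ 2)) := by
  have hnegc : ContDiff ℝ ∞ fun Q => -f Q := hf.neg
  have hnegL : LinkLipschitz (fun Q => -f Q) L := fun e g h hgh => by
    rw [← abs_neg]; convert hLip e g h hgh using 2; ring
  have key := gibbs_measureReal_deviation_ge_le_of_linkLipschitz hd hN hK hR hmod hc hc1 hK₀ hμ Δ hnegc hL hnegL hpos r
  have hneg : (matrixCylinder Δ fun Q => -f Q) = fun U => -matrixCylinder Δ f U := rfl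
  rw [hneg, integral_neg] at key
  refine le_trans (le_of_eq ?_) key
  congr 1
  ext U
  simp only [Set.mem_setOf_eq]
  constructor <;> intro h <;> linarith

/-- ★★ **Two-sided**: `μ{|F − E_μ F| ≥ r} ≤ 2e^{2/3} exp(−r/√(A ∑_e L_e²))`. [folklore] -/
theorem gibbs_measureReal_deviation_abs_ge_le_of_linkLipschitz (hd : 1 ≤ d) (hN : 1 ≤ N) {β R K c : ℝ} (hK : 0 ≤ K)
    (hR : |β| * (2 * ((d : ℝ) - 1)) ≤ R) (hmod : OneLinkKRModulus N R K) (hc : 6 * ((d : ℝ) - 1) * |β| * K ≤ c) (hc1 : c < 1)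
    (hK₀ : 0 < (N : ℝ) / 2 - N * |β| * (2 * ((d : ℝ) - 1)))
    {μ : Measure (LGConfig d (SUN N))} (hμ : μ ∈ ymGibbsMeasures (d := d) (fundamentalRep (Fin N)) ((N : ℝ) * β))
    (Δ : Finset (ZdEdge d)) {f : Cfg ↥Δ N → ℝ} (hf : ContDiff ℝ ∞ f) {L : ↥Δ → ℝ} (hL : ∀ e, 0 ≤ L e) (hLip : LinkLipschitz f L)
    (hpos : 0 < ∑ e, L e ^ 2) (r : ℝ) :
    μ.real {U | r ≤ |matrixCylinder Δ f U - ∫ V, matrixCylinder Δ f V ∂μ|} ≤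
      2 * Real.exp (2 / 3) * Real.exp (-r / Real.sqrt (((1 - c) * ((N : ℝ) / 2 - N * |β| * (2 * ((d : ℝ) - 1))))⁻¹ * ∑ e, L e ^ 2)) := by
  have hμ' : IsGibbsMeasure (ymSpecification (d := d) (fundamentalRep (Fin N)) ((N : ℝ) * β)) μ := hμ
  haveI := hμ'.isProbabilityMeasure
  have h1 := gibbs_measureReal_deviation_ge_le_of_linkLipschitz hd hN hK hR hmod hc hc1 hK₀ hμ Δ hf hL hLip hpos r
  have h2 := gibbs_measureReal_deviation_le_le_of_linkLipschitz hd hN hK hR hmod hc hc1 hK₀ hμ Δ hf hL hLip hpos r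
  have hsub : {U : LGConfig d (SUN N) | r ≤ |matrixCylinder Δ f U - ∫ V, matrixCylinder Δ f V ∂μ|} ⊆
      {U | r ≤ matrixCylinder Δ f U - ∫ V, matrixCylinder Δ f V ∂μ} ∪ {U | matrixCylinder Δ f U - ∫ V, matrixCylinder Δ f V ∂μ ≤ -r} := by
    intro U hU
    simp only [Set.mem_setOf_eq, Set.mem_union] at hU ⊢
    rcases le_or_gt 0 (matrixCylinder Δ f U - ∫ V, matrixCylinder Δ f V ∂μ) with h0 | h0
    · left; rwa [abs_of_nonneg h0] at hU
    · right; rw [abs_of_neg h0] at hU; linarith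
  calc μ.real {U | r ≤ |matrixCylinder Δ f U - ∫ V, matrixCylinder Δ f V ∂μ|}
      ≤ μ.real ({U | r ≤ matrixCylinder Δ f U - ∫ V, matrixCylinder Δ f V ∂μ} ∪ {U | matrixCylinder Δ f U - ∫ V, matrixCylinder Δ f V ∂μ ≤ -r}) :=
        measureReal_mono hsub
    _ ≤ _ := (measureReal_union_le _ _).trans (by linarith)

end Gibbs

/-! ### Cells -/

section Cells

/-- ★★ **`SU(2)`, `d = 4`, HYPOTHESIS-FREE on `0 ≤ β_W < 2/9`** (tree coupling `β_W/2`, quarter modulus; `A = ((1 − 9β_W/2)(1 − 3β_W))⁻¹`): for every DLR state `μ`,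
every smooth `f` over a finite `Δ` with `LinkLipschitz f L` (`L ≥ 0`, `∑ L² > 0`) and every `r`,
`μ{|F − E_μ F| ≥ r} ≤ 2e^{2/3} exp(−r √((1 − 9β_W/2)(1 − 3β_W)) / √(∑_e L_e²))`. [folklore] -/
theorem su2_gibbs_measureReal_deviation_abs_ge_le_of_linkLipschitz {βW : ℝ} (h0 : 0 ≤ βW) (h : βW < 2 / 9)
    {μ : Measure (LGConfig 4 (SUN 2))} (hμ : μ ∈ ymGibbsMeasures (d := 4) (fundamentalRep (Fin 2)) (βW / 2))
    (Δ : Finset (ZdEdge 4)) {f : Cfg ↥Δ 2 → ℝ} (hf : ContDiff ℝ ∞ f) {L : ↥Δ → ℝ} (hL : ∀ e, 0 ≤ L e) (hLip : LinkLipschitz f L)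
    (hpos : 0 < ∑ e, L e ^ 2) (r : ℝ) :
    μ.real {U | r ≤ |matrixCylinder Δ f U - ∫ V, matrixCylinder Δ f V ∂μ|} ≤
      2 * Real.exp (2 / 3) * Real.exp (-(r * Real.sqrt ((1 - 9 * βW / 2) * (1 - 3 * βW)) / Real.sqrt (∑ e, L e ^ 2))) := by
  have hβ : ((2 : ℕ) : ℝ) * (βW / 4) = βW / 2 := by push_cast; ring
  have habs : |βW / 4| = βW / 4 := abs_of_nonneg (by positivity)
  have hμ4 : μ ∈ ymGibbsMeasures (d := 4) (fundamentalRep (Fin 2)) (((2 : ℕ) : ℝ) * (βW / 4)) := by rwa [hβ]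
  have key := gibbs_measureReal_deviation_abs_ge_le_of_linkLipschitz (d := 4) (N := 2) (by norm_num) (by norm_num) (β := βW / 4) zero_le_one
    (R := 3 * βW / 2) (by rw [habs]; norm_num; linarith) (SlabAreaLawDimensions.su2_oneLinkKRModulus_of_le_one (by linarith))
    (c := 9 * βW / 2) (by rw [habs]; norm_num; linarith) (by linarith) (by rw [habs]; norm_num; linarith) hμ4 Δ hf hL hLip hpos r
  have e : (1 - 9 * βW / 2) * (((2 : ℕ) : ℝ) / 2 - (2 : ℕ) * |βW / 4| * (2 * (((4 : ℕ) : ℝ) - 1))) = (1 - 9 * βW / 2) * (1 - 3 * βW) := by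
    rw [habs]; push_cast; ring
  rw [e] at key
  refine key.trans (le_of_eq ?_)
  have hP : 0 < (1 - 9 * βW / 2) * (1 - 3 * βW) := mul_pos (by linarith) (by linarith)
  congr 2
  rw [Real.sqrt_mul' _ hpos.le, Real.sqrt_inv]
  have hS : Real.sqrt (∑ e, L e ^ 2) ≠ 0 := (Real.sqrt_pos.2 hpos).ne'
  have hs : Real.sqrt ((1 - 9 * βW / 2) * (1 - 3 * βW)) ≠ 0 := (Real.sqrt_pos.2 hP).ne'
  field_simp

/-- ★ **EVERY `SU(N)`, `N ≥ 2`, `d = 4`, HYPOTHESIS-FREE on 't Hooft `0 ≤ b < 1/48`** (bare `Nb`, Bakry–Émery one-link modulus; `A = (N(1/2 − 24b))⁻¹`): for every DLR state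
`μ`, every smooth per-link-Lipschitz `f` over a finite `Δ` and every `r`, `μ{|F − E_μ F| ≥ r} ≤ 2e^{2/3} exp(−r √(N(1/2 − 24b)) / √(∑_e L_e²))` — for normalised loop
observables (`L_e = O(N^{-1/2})`) this is concentration at rate `N·r`. [folklore] -/
theorem suN_gibbs_measureReal_deviation_abs_ge_le_bakryEmery (hN : 2 ≤ N) {b : ℝ} (hb0 : 0 ≤ b) (hb : b < 1 / 48)
    {μ : Measure (LGConfig 4 (SUN N))} (hμ : μ ∈ ymGibbsMeasures (d := 4) (fundamentalRep (Fin N)) ((N : ℝ) * b))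
    (Δ : Finset (ZdEdge 4)) {f : Cfg ↥Δ N → ℝ} (hf : ContDiff ℝ ∞ f) {L : ↥Δ → ℝ} (hL : ∀ e, 0 ≤ L e) (hLip : LinkLipschitz f L)
    (hpos : 0 < ∑ e, L e ^ 2) (r : ℝ) :
    μ.real {U | r ≤ |matrixCylinder Δ f U - ∫ V, matrixCylinder Δ f V ∂μ|} ≤
      2 * Real.exp (2 / 3) * Real.exp (-(r * Real.sqrt ((N : ℝ) * (1 / 2 - 24 * b)) / Real.sqrt (∑ e, L e ^ 2))) := by
  have hN0 : (0 : ℝ) < N := by exact_mod_cast (show 0 < N by omega)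
  have habs : |b| = b := abs_of_nonneg hb0
  have hden : 0 < 1 / 2 - 6 * b := by linarith
  have hc1 : 18 * b / (1 / 2 - 6 * b) < 1 := by rw [div_lt_one hden]; linarith
  have hK₀ : 0 < (N : ℝ) / 2 - N * |b| * (2 * (((4 : ℕ) : ℝ) - 1)) := by rw [habs]; push_cast; nlinarith
  have key := gibbs_measureReal_deviation_abs_ge_le_of_linkLipschitz (d := 4) (N := N) (by norm_num) (by omega) (β := b) (K := 1 / (1 / 2 - 6 * b))
    (by positivity) (R := 6 * b) (by rw [habs]; push_cast; linarith) (Balaban1983to89.StrongCouplingKernelWindow.oneLinkKRModulus_SU hN (by linarith))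
    (c := 18 * b / (1 / 2 - 6 * b)) (by rw [habs]; push_cast; exact le_of_eq (by field_simp; ring)) hc1 hK₀ hμ Δ hf hL hLip hpos r
  have e : (1 - 18 * b / (1 / 2 - 6 * b)) * ((N : ℝ) / 2 - N * |b| * (2 * (((4 : ℕ) : ℝ) - 1))) = N * (1 / 2 - 24 * b) := by
    rw [habs]; push_cast
    rw [show (N : ℝ) / 2 - N * b * (2 * (4 - 1)) = N * (1 / 2 - 6 * b) by ring, sub_mul, one_mul, div_mul_eq_mul_div,
      show 18 * b * ((N : ℝ) * (1 / 2 - 6 * b)) = 18 * b * N * (1 / 2 - 6 * b) by ring, mul_div_assoc, div_self hden.ne', mul_one]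
    ring
  rw [e] at key
  refine key.trans (le_of_eq ?_)
  have hP : 0 < (N : ℝ) * (1 / 2 - 24 * b) := mul_pos hN0 (by linarith)
  congr 2
  rw [Real.sqrt_mul' _ hpos.le, Real.sqrt_inv]
  have hS : Real.sqrt (∑ e, L e ^ 2) ≠ 0 := (Real.sqrt_pos.2 hpos).ne'
  have hs : Real.sqrt ((N : ℝ) * (1 / 2 - 24 * b)) ≠ 0 := (Real.sqrt_pos.2 hP).ne'
  field_simp

/-- ★ **`SU(3)`, `d = 4`, HYPOTHESIS-FREE (twisted modulus `OneLinkKRModulus 3 (1/5) (3531/2000)`) on `0 ≤ β_W < 1000/3531`** (tree coupling `β_W/3`;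
`A = ((1 − 3531β_W/1000)(3/2 − 2β_W))⁻¹`): `μ{|F − E_μ F| ≥ r} ≤ 2e^{2/3} exp(−r √((1 − 3531β_W/1000)(3/2 − 2β_W)) / √(∑_e L_e²))`. [folklore] -/
theorem su3_gibbs_measureReal_deviation_abs_ge_le_pv2t {βW : ℝ} (h0 : 0 ≤ βW) (h : βW < 1000 / 3531)
    {μ : Measure (LGConfig 4 (SUN 3))} (hμ : μ ∈ ymGibbsMeasures (d := 4) (fundamentalRep (Fin 3)) (βW / 3))
    (Δ : Finset (ZdEdge 4)) {f : Cfg ↥Δ 3 → ℝ} (hf : ContDiff ℝ ∞ f) {L : ↥Δ → ℝ} (hL : ∀ e, 0 ≤ L e) (hLip : LinkLipschitz f L)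
    (hpos : 0 < ∑ e, L e ^ 2) (r : ℝ) :
    μ.real {U | r ≤ |matrixCylinder Δ f U - ∫ V, matrixCylinder Δ f V ∂μ|} ≤
      2 * Real.exp (2 / 3) * Real.exp (-(r * Real.sqrt ((1 - 3531 * βW / 1000) * (3 / 2 - 2 * βW)) / Real.sqrt (∑ e, L e ^ 2))) := by
  have hβ : ((3 : ℕ) : ℝ) * (βW / 9) = βW / 3 := by push_cast; ring
  have habs : |βW / 9| = βW / 9 := abs_of_nonneg (by positivity)
  have hμ9 : μ ∈ ymGibbsMeasures (d := 4) (fundamentalRep (Fin 3)) (((3 : ℕ) : ℝ) * (βW / 9)) := by rwa [hβ]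
  have key := gibbs_measureReal_deviation_abs_ge_le_of_linkLipschitz (d := 4) (N := 3) (by norm_num) (by norm_num) (β := βW / 9) (by norm_num)
    (R := 1 / 5) (by rw [habs]; push_cast; linarith) TwistedBochner.su3_oneLinkKRModulus_pv2t_oneFifth (c := 3531 * βW / 1000)
    (by rw [habs]; push_cast; linarith) (by linarith) (by rw [habs]; push_cast; linarith) hμ9 Δ hf hL hLip hpos r
  have e : (1 - 3531 * βW / 1000) * (((3 : ℕ) : ℝ) / 2 - (3 : ℕ) * |βW / 9| * (2 * (((4 : ℕ) : ℝ) - 1))) =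
      (1 - 3531 * βW / 1000) * (3 / 2 - 2 * βW) := by
    rw [habs]; push_cast; ring
  rw [e] at key
  refine key.trans (le_of_eq ?_)
  have hP : 0 < (1 - 3531 * βW / 1000) * (3 / 2 - 2 * βW) := mul_pos (by linarith) (by linarith)
  congr 2
  rw [Real.sqrt_mul' _ hpos.le, Real.sqrt_inv]
  have hS : Real.sqrt (∑ e, L e ^ 2) ≠ 0 := (Real.sqrt_pos.2 hpos).ne'
  have hs : Real.sqrt ((1 - 3531 * βW / 1000) * (3 / 2 - 2 * βW)) ≠ 0 := (Real.sqrt_pos.2 hP).ne'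
  field_simp

end Cells

end Summit.Ventures.YMGap.RobustBall.LangevinPoincare

end
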